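import Literature.Geometry.Riemannian.MetricFlow
import Mathlib.Analysis.Calculus.ContDiff.Deriv
import Mathlib.Analysis.SpecialFunctions.ExpDeriv
import HarnessLib

/-!
# Calculus of Bamler's `Φ` (Bamler 2023, §3, (3.1); Bamler 2020a, §4.1)

`MetricFlow.Phi` (`MetricFlow.lean`) is Bamler's `Φ : ℝ → (0, 1)`, "the antiderivative
`Φ'(x) = (4π)^{-1/2} e^{-x²/4}`, `lim_{x → −∞} Φ(x) = 0`, `lim_{x → ∞} Φ(x) = 1`" (R. Bamler,
*Compactness theory of the space of super Ricci flows*, Invent. Math. 233 (2023), §3, (3.1);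
*Entropy and heat kernel bounds on a Ricci flow background*, arXiv:2008.07093, §4.1), defined there
as the distribution function of the centred Gaussian of variance `2`. This file proves the calculus
facts that the gradient estimate (2020a, Thm. 4.1: "`Φ''_t(x) = −(x/2t) Φ'_t`") and item (6) of
the definition of a metric flow use:

* `MetricFlow.hasDerivAt_Phi`, `deriv_Phi` — `Φ'(x) = (4π)^{-1/2} e^{-x²/4}` (fundamental theorem
  of calculus on `Phi_eq_integral`);
* `differentiable_Phi`, `contDiff_Phi` — `Φ` is `C^∞`;
* `deriv_Phi_pos`, `Phi_strictMono`, `Phi_pos`, `Phi_lt_one` — `Φ' > 0`, `Φ` is strictly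
  increasing with values in `(0, 1)`;
* `deriv_deriv_Phi` — `Φ'' = −(x/2) Φ'`;
* `exists_Phi_eq` — `Φ` attains every value of `(0, 1)` (intermediate value theorem).

Everything is proved; no definitions, no named facts. What is NOT here: the inverse `Φ⁻¹` on
`(0, 1)` and its smoothness, the rescaled `Φ_t(x) = Φ(t^{-1/2} x)`.

## References

* R. H. Bamler, *Compactness theory of the space of super Ricci flows*, Invent. Math. 233 (2023),
  §3, (3.1). [Bamler2023]
* R. H. Bamler, *Entropy and heat kernel bounds on a Ricci flow background*, arXiv:2008.07093
  (2020), §4.1 (`Φ`, `Φ_t`, `Φ''_t = −(x/2t)Φ'_t`). [Bamler2020Entropy]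
-/

noncomputable section

open Set MeasureTheory ProbabilityTheory Filter
open scoped Topology ContDiff

namespace Literature.Geometry.Riemannian

namespace MetricFlow

/-- The density `(4π)^{-1/2} e^{-x²/4}` is the Gaussian density of mean `0` and variance `2`.
[cite: Bamler2023, §3, (3.1)] -/
theorem gaussianPDFReal_zero_two (y : ℝ) :
    gaussianPDFReal 0 2 y = (Real.sqrt (4 * Real.pi))⁻¹ * Real.exp (-y ^ 2 / 4) := by
  rw [gaussianPDFReal]
  push_cast
  rw [show (2 : ℝ) * Real.pi * 2 = 4 * Real.pi by ring,
    show -(y - 0) ^ 2 / (2 * 2) = -y ^ 2 / 4 by ring]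

/-- The density `(4π)^{-1/2} e^{-x²/4}` is continuous. [folklore] -/
theorem continuous_Phi_density :
    Continuous fun y : ℝ ↦ (Real.sqrt (4 * Real.pi))⁻¹ * Real.exp (-y ^ 2 / 4) := by
  fun_prop

/-- The density `(4π)^{-1/2} e^{-x²/4}` is integrable on `ℝ`. [folklore] -/
theorem integrable_Phi_density :
    Integrable fun y : ℝ ↦ (Real.sqrt (4 * Real.pi))⁻¹ * Real.exp (-y ^ 2 / 4) := by
  have e : (fun y : ℝ ↦ (Real.sqrt (4 * Real.pi))⁻¹ * Real.exp (-y ^ 2 / 4)) = gaussianPDFReal 0 2 :=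
    funext fun y ↦ (gaussianPDFReal_zero_two y).symm
  rw [e]
  exact integrable_gaussianPDFReal 0 2

/-- `Φ(x) = Φ(0)-part + ∫₀ˣ (4π)^{-1/2} e^{-y²/4} dy`: the interval-integral form of
`Phi_eq_integral`. [cite: Bamler2023, §3, (3.1)] -/
theorem Phi_eq_const_add_intervalIntegral (x : ℝ) :
    Phi x = (∫ y in Iic (0 : ℝ), (Real.sqrt (4 * Real.pi))⁻¹ * Real.exp (-y ^ 2 / 4)) +
      ∫ y in (0 : ℝ)..x, (Real.sqrt (4 * Real.pi))⁻¹ * Real.exp (-y ^ 2 / 4) := by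
  rw [Phi_eq_integral, ← intervalIntegral.integral_Iic_sub_Iic integrable_Phi_density.integrableOn
    integrable_Phi_density.integrableOn]
  ring

/-- **`Φ'(x) = (4π)^{-1/2} e^{-x²/4}`** (Bamler 2023, (3.1): "`Φ` is the antiderivative of
`(4π)^{-1/2} e^{-x²/4}`"), by the fundamental theorem of calculus. [cite: Bamler2023, §3, (3.1)] -/
theorem hasDerivAt_Phi (x : ℝ) :
    HasDerivAt Phi ((Real.sqrt (4 * Real.pi))⁻¹ * Real.exp (-x ^ 2 / 4)) x := by
  have e : Phi = fun x ↦ (∫ y in Iic (0 : ℝ), (Real.sqrt (4 * Real.pi))⁻¹ * Real.exp (-y ^ 2 / 4)) +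
      ∫ y in (0 : ℝ)..x, (Real.sqrt (4 * Real.pi))⁻¹ * Real.exp (-y ^ 2 / 4) :=
    funext Phi_eq_const_add_intervalIntegral
  rw [e]
  exact (intervalIntegral.integral_hasDerivAt_right
    (integrable_Phi_density.intervalIntegrable) (continuous_Phi_density.stronglyMeasurableAtFilter _ _)
    continuous_Phi_density.continuousAt).const_add _

/-- `Φ' = (4π)^{-1/2} e^{-x²/4}` as a `deriv`. [cite: Bamler2023, §3, (3.1)] -/
theorem deriv_Phi (x : ℝ) : deriv Phi x = (Real.sqrt (4 * Real.pi))⁻¹ * Real.exp (-x ^ 2 / 4) :=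
  (hasDerivAt_Phi x).deriv

/-- `Φ'` as a function. [cite: Bamler2023, §3, (3.1)] -/
theorem deriv_Phi_eq : deriv Phi = fun x ↦ (Real.sqrt (4 * Real.pi))⁻¹ * Real.exp (-x ^ 2 / 4) :=
  funext deriv_Phi

/-- `Φ` is differentiable. [cite: Bamler2023, §3, (3.1)] -/
theorem differentiable_Phi : Differentiable ℝ Phi := fun x ↦ (hasDerivAt_Phi x).differentiableAt

/-- **`Φ` is `C^∞`.** [cite: Bamler2023, §3, (3.1)] -/
theorem contDiff_Phi : ContDiff ℝ ∞ Phi := by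
  rw [contDiff_infty_iff_deriv]
  refine ⟨differentiable_Phi, ?_⟩
  rw [deriv_Phi_eq]
  fun_prop

/-- **`Φ' > 0`.** [cite: Bamler2023, §3, (3.1)] -/
theorem deriv_Phi_pos (x : ℝ) : 0 < deriv Phi x := by
  rw [deriv_Phi]
  have h4 : 0 < Real.sqrt (4 * Real.pi) := Real.sqrt_pos.2 (by positivity)
  positivity

/-- **`Φ` is strictly increasing.** [cite: Bamler2023, §3, (3.1)] -/
theorem Phi_strictMono : StrictMono Phi := strictMono_of_deriv_pos deriv_Phi_pos

/-- **`0 < Φ`** (values in `(0, 1)`, Bamler 2020a §4.1: `Φ : ℝ → (0,1)`). [cite: Bamler2020Entropy, §4.1] -/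
theorem Phi_pos (x : ℝ) : 0 < Phi x :=
  lt_of_le_of_lt (Phi_mem_Icc (x - 1)).1 (Phi_strictMono (by linarith))

/-- **`Φ < 1`** (values in `(0, 1)`). [cite: Bamler2020Entropy, §4.1] -/
theorem Phi_lt_one (x : ℝ) : Phi x < 1 :=
  lt_of_lt_of_le (Phi_strictMono (by linarith : x < x + 1)) (Phi_mem_Icc (x + 1)).2

/-- **`Φ'' = −(x/2) Φ'`** (Bamler 2020a, proof of Thm. 4.1: "`Φ''_t(x) = −(x/2t) Φ'_t`", here
`t = 1`). [cite: Bamler2020Entropy, §4.2] -/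
theorem deriv_deriv_Phi (x : ℝ) : deriv (deriv Phi) x = -(x / 2) * deriv Phi x := by
  rw [deriv_Phi_eq]
  have h : HasDerivAt (fun x : ℝ ↦ (Real.sqrt (4 * Real.pi))⁻¹ * Real.exp (-x ^ 2 / 4))
      ((Real.sqrt (4 * Real.pi))⁻¹ * (Real.exp (-x ^ 2 / 4) * (-(2 * x) / 4))) x := by
    have h1 : HasDerivAt (fun x : ℝ ↦ -x ^ 2 / 4) (-(2 * x) / 4) x := by
      simpa using ((hasDerivAt_pow 2 x).neg).div_const 4
    exact (h1.exp).const_mul _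
  rw [h.deriv]
  ring

/-- **`Φ` attains every value of `(0, 1)`** (it is continuous with limits `0` at `−∞` and `1` at
`+∞`; intermediate value theorem). [cite: Bamler2020Entropy, §4.1] -/
theorem exists_Phi_eq {c : ℝ} (hc0 : 0 < c) (hc1 : c < 1) : ∃ x, Phi x = c := by
  obtain ⟨a, ha⟩ := ((tendsto_order.1 tendsto_Phi_atBot).2 c hc0).exists
  obtain ⟨b, hb⟩ := ((tendsto_order.1 tendsto_Phi_atTop).1 c hc1).exists
  have hab : a ≤ b := by
    by_contra h
    have := Phi_strictMono (lt_of_not_ge h)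
    linarith
  obtain ⟨x, -, hx⟩ := intermediate_value_Icc hab differentiable_Phi.continuous.continuousOn
    ⟨ha.le, hb.le⟩
  exact ⟨x, hx⟩

end MetricFlow

end Literature.Geometry.Riemannian

end
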